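import Summits.CriticalPhenomena.PercolationContinuityZ3.Theorems.PercNearOneGluingNoHeavyConstsMDLXJointXEdgeInduction
import HarnessLib

/-!
# MDL(X)′ from CROSS at ONE pair of the avoided set per functional (the existential form of the X-edge induction)
# (PAPER-2 track (ii): constants of the CSH family; seat `prim-consts-2`, gen 18)

builds on p205010 (kernel theorem, internal audit signed; external expert review pending).  Support file (`--supports
stmt-CriticalPhenomena-4575`); memo `run/shared/lean/prim/consts/FROM-prim-consts-2-g18-XEDGE-CROSS.md` §3.  One `Prop` definition (an OPEN statement
of this programme, tagged `@[conjecture]`), theorems; no sorries; standard axioms.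

`Consts.mdlxJoint_of_crossRel` (companion file) needs the CROSS members `M₁, M₂ ≥ 0` for EVERY pair `s(x,u)` at the avoided set.  The induction only ever
expands ONE pair, of our choosing, and the choice may depend on the functional `F`.  This file records the correspondingly weaker hypothesis:

* `Consts.CrossRelExists` — **CONJECTURE (OPEN; implied by `Consts.CrossRel`, `Consts.crossRelExists_of_crossRel`)**: for every weighted graph with a pair of
  nonzero weight at `X`, every placement with `s, y ∉ X`, `s ≠ y`, and every monotone `F`, if MDL(X)′ holds for every single-pair deletion of the weights
  (all placements, all monotone functionals), then SOME pair `s(x,u)` (`x ∈ X`, `u ≠ x`, nonzero weight) has `u ∈ X ∪ {s, y}` or nonnegative CROSS members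
  at `F` for the weights with that pair deleted.
* `Consts.mdlxJoint_of_crossRelExists` — **THEOREM: `CrossRelExists → MDLXJoint`** (the same strong induction on the number of pairs of nonzero weight).
So a proof of MDL(X)′ may pick, for each functional, the most convenient pair at the avoided set (e.g. one towards the owner, or one maximising the
enlarged constant `p_{X∪u}`); the exact census of the companion file says every pair works.
[cite: VandenbergHaggstromKahn2005, Thm. 1.1 (pp. 3–5), §2.1 (pp. 9–13)] [cite: Grimmett1999, §2.4]
-/

noncomputable section

namespace Summit.CriticalPhenomena.PercolationContinuityZ3.Theorems

open MeasureTheory Set Literature.Probability.LatticeModels Literature.Probability.Percolation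
open scoped Classical

namespace Consts

/-- **CONJECTURE (existential CROSS; OPEN, this programme; implied by `Consts.CrossRel`).**  For all `n`, weights `w`, `s ≠ y`, `X ∌ s, y`, `z`, and monotone
`F`: if some pair `s(x,u)` with `x ∈ X`, `u ≠ x` has nonzero weight, and MDL(X)′ holds (all placements, all monotone functionals) for every weight vector
obtained from `w` by switching off one pair of nonzero weight, then there is such a pair `s(x,u)` with `u ∈ X`, `u = s`, `u = y`, or both CROSS members
(`Consts.polMargin` sums `P(X',X,X)+P(X,X',X)+P(X,X,X')`, `P(X',X',X)+P(X',X,X')+P(X,X',X')`, `X' = X ∪ {u}`, for `w` with `s(x,u)` switched off) nonnegative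
at `F`.  Implies `Consts.MDLXJoint` (`Consts.mdlxJoint_of_crossRelExists`).
builds on p205010 (kernel theorem, internal audit signed; external expert review pending).
[cite: VandenbergHaggstromKahn2005, Thm. 1.1 (pp. 3–5), §2.1 (pp. 9–13)] [status: open] -/
@[conjecture] def CrossRelExists : Prop :=
  ∀ (n : ℕ) (w : Sym2 (Fin n) → unitInterval) (s y z : Fin n) (X : Set (Fin n)),
    s ≠ y → s ∉ X → y ∉ X →
    (∃ x ∈ X, ∃ u : Fin n, u ≠ x ∧ w s(x, u) ≠ 0) →
    (∀ e : Sym2 (Fin n), w e ≠ 0 → ∀ (s' y' z' : Fin n) (X' : Set (Fin n)), s' ≠ y' → ∀ G : Set (Sym2 (Fin n)) → ℝ, Monotone G →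
        0 ≤ polMargin (prodBernoulli fun d => if d = e then 0 else w d) s' y' z' G X' X' X') →
    ∀ F : Set (Sym2 (Fin n)) → ℝ, Monotone F →
      ∃ x ∈ X, ∃ u : Fin n, u ≠ x ∧ w s(x, u) ≠ 0 ∧
        (u ∈ X ∨ u = s ∨ u = y ∨
          (0 ≤ polMargin (prodBernoulli fun d => if d = s(x, u) then 0 else w d) s y z F (insert u X) X X +
                  polMargin (prodBernoulli fun d => if d = s(x, u) then 0 else w d) s y z F X (insert u X) X +
                polMargin (prodBernoulli fun d => if d = s(x, u) then 0 else w d) s y z F X X (insert u X) ∧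
            0 ≤ polMargin (prodBernoulli fun d => if d = s(x, u) then 0 else w d) s y z F (insert u X) (insert u X) X +
                  polMargin (prodBernoulli fun d => if d = s(x, u) then 0 else w d) s y z F (insert u X) X (insert u X) +
                polMargin (prodBernoulli fun d => if d = s(x, u) then 0 else w d) s y z F X (insert u X) (insert u X)))

/-- `CrossRel` implies its existential form (any pair of nonzero weight at `X` will do). [cite: VandenbergHaggstromKahn2005, Thm. 1.1 (pp. 3–5)] -/
theorem crossRelExists_of_crossRel (hC : CrossRel) : CrossRelExists := by
  intro n w s y z X hsy hs hy hex hIH F hF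
  obtain ⟨x, hx, u, hux, hwe⟩ := hex
  refine ⟨x, hx, u, hux, hwe, ?_⟩
  by_cases huX : u ∈ X
  · exact Or.inl huX
  by_cases hus : u = s
  · exact Or.inr (Or.inl hus)
  by_cases huy : u = y
  · exact Or.inr (Or.inr (Or.inl huy))
  right; right; right
  exact hC n (fun d => if d = s(x, u) then 0 else w d) s y z u X hsy hs hy huX hus huy
    (fun s' y' z' X' h' G hG => hIH s(x, u) hwe s' y' z' X' h' G hG) F hF

/-- The four Bernstein members at a pair `s(x,u)` from the case disjunction of `Consts.CrossRelExists` and MDL(X)′ for the pair-deleted weights.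
[cite: VandenbergHaggstromKahn2005, Thm. 1.1 (pp. 3–5)] -/
theorem members_nonneg_of_cases {n : ℕ} (w₀ : Sym2 (Fin n) → unitInterval) (s y z u : Fin n) (X : Set (Fin n))
    (hsy : s ≠ y) (hs : s ∉ X) (hy : y ∉ X)
    (IH : ∀ (s' y' z' : Fin n) (X' : Set (Fin n)), s' ≠ y' → ∀ G : Set (Sym2 (Fin n)) → ℝ, Monotone G →
        0 ≤ polMargin (prodBernoulli w₀) s' y' z' G X' X' X')
    (F : Set (Sym2 (Fin n)) → ℝ) (hF : Monotone F)
    (hcase : u ∈ X ∨ u = s ∨ u = y ∨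
      (0 ≤ polMargin (prodBernoulli w₀) s y z F (insert u X) X X + polMargin (prodBernoulli w₀) s y z F X (insert u X) X +
            polMargin (prodBernoulli w₀) s y z F X X (insert u X) ∧
        0 ≤ polMargin (prodBernoulli w₀) s y z F (insert u X) (insert u X) X +
              polMargin (prodBernoulli w₀) s y z F (insert u X) X (insert u X) +
            polMargin (prodBernoulli w₀) s y z F X (insert u X) (insert u X))) :
    0 ≤ polMargin (prodBernoulli w₀) s y z F X X X ∧
      0 ≤ polMargin (prodBernoulli w₀) s y z F (insert u X) X X + polMargin (prodBernoulli w₀) s y z F X (insert u X) X +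
            polMargin (prodBernoulli w₀) s y z F X X (insert u X) ∧
        0 ≤ polMargin (prodBernoulli w₀) s y z F (insert u X) (insert u X) X +
              polMargin (prodBernoulli w₀) s y z F (insert u X) X (insert u X) +
            polMargin (prodBernoulli w₀) s y z F X (insert u X) (insert u X) ∧
          0 ≤ polMargin (prodBernoulli w₀) s y z F (insert u X) (insert u X) (insert u X) := by
  have h0 : 0 ≤ polMargin (prodBernoulli w₀) s y z F X X X := IH s y z X hsy F hF
  refine ⟨h0, ?_⟩
  rcases hcase with huX | hus | huy | ⟨h1, h2⟩
  · rw [Set.insert_eq_of_mem huX]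
    exact ⟨by linarith, by linarith, h0⟩
  · subst hus
    rw [polMargin_eq_zero_of_slot0 _ u y z F (insert u X) X X (Or.inl (Set.mem_insert u X)),
      polMargin_eq_zero_of_slot1 _ u y z F X (insert u X) X (Set.mem_insert u X),
      polMargin_eq_zero_of_slot2 _ u y z F X X (insert u X) (Set.mem_insert u X),
      polMargin_eq_zero_of_slot0 _ u y z F (insert u X) (insert u X) X (Or.inl (Set.mem_insert u X)),
      polMargin_eq_zero_of_slot0 _ u y z F (insert u X) X (insert u X) (Or.inl (Set.mem_insert u X)),
      polMargin_eq_zero_of_slot1 _ u y z F X (insert u X) (insert u X) (Set.mem_insert u X),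
      polMargin_eq_zero_of_slot0 _ u y z F (insert u X) (insert u X) (insert u X) (Or.inl (Set.mem_insert u X))]
    simp
  · subst huy
    have hm := crossRel_marker w₀ s u z X hsy hs hy F hF (IH s u z X hsy)
    refine ⟨hm.1, hm.2, ?_⟩
    exact (polMargin_eq_zero_of_slot0 _ s u z F (insert u X) (insert u X) (insert u X)
      (Or.inr (Set.mem_insert_of_mem s (Set.mem_insert u X)))).symm.le
  · exact ⟨h1, h2, IH s y z (insert u X) hsy F hF⟩

/-- The induction behind `Consts.mdlxJoint_of_crossRelExists`. [cite: VandenbergHaggstromKahn2005, Thm. 1.1 (pp. 3–5)] -/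
theorem polMargin_nonneg_of_crossRelExists (hC : CrossRelExists) (n : ℕ) :
    ∀ (k : ℕ) (w : Sym2 (Fin n) → unitInterval), (Finset.univ.filter fun d => w d ≠ 0).card = k →
      ∀ (s y z : Fin n) (X : Set (Fin n)), s ≠ y → ∀ F : Set (Sym2 (Fin n)) → ℝ, Monotone F →
        0 ≤ polMargin (prodBernoulli w) s y z F X X X := by
  intro k
  induction k using Nat.strong_induction_on with
  | _ k ih =>
    intro w hk s y z X hsy F hF
    by_cases hs : s ∈ X
    · exact (polMargin_eq_zero_of_slot0 _ s y z F X X X (Or.inl hs)).symm.le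
    by_cases hy : y ∈ X
    · exact (polMargin_eq_zero_of_slot0 _ s y z F X X X (Or.inr (Set.mem_insert_of_mem s hy))).symm.le
    by_cases hex : ∃ x ∈ X, ∃ u : Fin n, u ≠ x ∧ w s(x, u) ≠ 0
    · -- deleting any pair of nonzero weight lowers the count, so MDL(X)′ is available for every single-pair deletion
      have hlt : ∀ e : Sym2 (Fin n), w e ≠ 0 →
          (Finset.univ.filter fun d : Sym2 (Fin n) => (if d = e then (0 : unitInterval) else w d) ≠ 0).card < k := by
        intro e hwe
        have hsub : (Finset.univ.filter fun d : Sym2 (Fin n) => (if d = e then (0 : unitInterval) else w d) ≠ 0) =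
            (Finset.univ.filter fun d => w d ≠ 0).erase e := by
          ext d
          simp only [Finset.mem_filter, Finset.mem_univ, true_and, Finset.mem_erase]
          by_cases hde : d = e
          · rw [if_pos hde]
            constructor
            · intro h; exact absurd rfl h
            · rintro ⟨h, -⟩; exact absurd hde h
          · rw [if_neg hde]
            constructor
            · intro h; exact ⟨hde, h⟩
            · rintro ⟨-, h⟩; exact h
        rw [hsub, ← hk]
        exact Finset.card_erase_lt_of_mem (Finset.mem_filter.2 ⟨Finset.mem_univ _, hwe⟩)
      have IH : ∀ e : Sym2 (Fin n), w e ≠ 0 → ∀ (s' y' z' : Fin n) (X' : Set (Fin n)), s' ≠ y' →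
          ∀ G : Set (Sym2 (Fin n)) → ℝ, Monotone G →
            0 ≤ polMargin (prodBernoulli fun d => if d = e then (0 : unitInterval) else w d) s' y' z' G X' X' X' :=
        fun e hwe s' y' z' X' h' G hG => ih _ (hlt e hwe) (fun d => if d = e then (0 : unitInterval) else w d) rfl s' y' z' X' h' G hG
      obtain ⟨x, hx, u, hux, hwe, hcase⟩ := hC n w s y z X hsy hs hy hex IH F hF
      obtain ⟨m0, m1, m2, m3⟩ :=
        members_nonneg_of_cases (fun d => if d = s(x, u) then (0 : unitInterval) else w d) s y z u X hsy hs hy (IH s(x, u) hwe) F hF hcase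
      refine polMargin_nonneg_of_members w s y z x u X hx F ?_ ?_ ?_ ?_
      · convert m0
      · convert m1
      · convert m2
      · convert m3
    · push Not at hex
      exact polMargin_nonneg_of_isolated w s y z X hsy hs (fun x hx u hu => hex x hx u hu) F hF

/-- **THEOREM: existential CROSS ⟹ MDL(X)′** (`Consts.CrossRelExists → Consts.MDLXJoint`).
[cite: VandenbergHaggstromKahn2005, Thm. 1.1 (pp. 3–5), §2.1 (pp. 9–13)] -/
theorem mdlxJoint_of_crossRelExists (hC : CrossRelExists) : MDLXJoint :=
  mdlxJoint_iff_polMargin.2 fun n w s y z X hsy F hF =>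
    polMargin_nonneg_of_crossRelExists hC n _ w rfl s y z X hsy F hF

end Consts

end Summit.CriticalPhenomena.PercolationContinuityZ3.Theorems

end
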